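import Summits.HodgeConjecture.CorCM.Census.SexticOcticWeilParts
import HarnessLib

/-!
# `E × T × B` over a sextic and an octic CM field sharing `k`: the composite parts SPLIT into curve points, three parts and quad parts,
# and every part is BALANCED at every pair of permutations

COR-CM (cell `pub-hodgecm2`), seat b30 gen 26 (2026-08-23); count-neutral own lane SEXTIC-OCTIC, sequel of
`Census/SexticOcticWeilParts.lean` (the part predicates `IsPairPartS`, `IsThreePartS`, `IsQuadPartS`, `IsFourPartS`, `IsSixPartS`,
`IsEightPartS`, `IsTenPartS` and their count functions).  Theorems of the finite model only; no definition, no named fact, no geometry,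
no `sorry`, no `decide`.

* §1 `IsFourPartS.exists_split` (curve point + three part), `IsSixPartS.exists_split` (two curve points + quad part),
  `IsEightPartS.exists_split` (curve point + three part of sign `b` + quad part of sign `¬b`), `IsTenPartS.exists_split` (two three
  parts of sign `b` + quad part of sign `¬b`);
* §2 **balance at EVERY pair of permutations** via the defect law `Census/SexticOcticWeilDefect.balancedS_of_defect`, with defects
  `(t₁, t₂; e) = (0, 0; 0)` (pair), `(±1, 0; ±1)` (four: the Weil class of `T × E`), `(0, ±1; ±2)` (six: `B × E × E`),
  `(±1, ∓1; ∓1)` (eight: `Ē × T × B̄`), `(±2, ∓1; 0)` (ten: `T × T × B̄`) — so removing a part from a balanced configuration keeps it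
  balanced, whatever the realised set `R`.
[cite: MoonenZarhin1995Duke, Thm. 2.4] [cite: Gordon1999HodgeAVSurvey, 5.13 (ii), 9.2.2] [cite: Milne2020HodgeClassesAV, 1.2 (a)]

## References
* [MoonenZarhin1995Duke] B. Moonen, Yu. Zarhin, Duke Math. J. 77 (1995), Thm. 2.4.  [Gordon1999HodgeAVSurvey] B. B. Gordon, CRM
  Monogr. 10 (1999), 5.13 (ii), 9.2.2.  [Milne2020HodgeClassesAV] J. S. Milne, arXiv:2010.08857, 1.2 (a).
-/

namespace Summit.HodgeConjecture.CorCM.Census.SexticOcticWeil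

open Finset

variable {α : Type*} {v : α → PtS}

/-! ### Splitting the composite parts -/

/-- A four part is its curve point plus a three part. [folklore] -/
theorem IsFourPartS.exists_split [DecidableEq α] {b : Bool} {G : Finset α} (hG : IsFourPartS v b G) :
    ∃ (x : α) (G₁ : Finset α), x ∉ G₁ ∧ G = insert x G₁ ∧ v x = Sum.inl b ∧ IsThreePartS v b G₁ := by
  obtain ⟨x, hxf⟩ := Finset.card_eq_one.1 hG.2.1
  have hx : x ∈ G.filter fun x => v x = Sum.inl b := by rw [hxf]; exact Finset.mem_singleton_self x
  obtain ⟨hxG, hvx⟩ := Finset.mem_filter.1 hx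
  obtain ⟨W, hW, hW'⟩ := exists_threePartS_of_counts (v := v) (T := G) b fun a => by rw [hG.2.2 a]; exact one_pos
  have hxW : x ∉ W := fun h => by
    obtain ⟨a, ha⟩ := hW'.exists_eq h
    rw [hvx] at ha; exact Sum.inl_ne_inr ha
  refine ⟨x, W, hxW, ?_, hvx, hW'⟩
  symm
  apply Finset.eq_of_subset_of_card_le (Finset.insert_subset hxG hW)
  rw [Finset.card_insert_of_notMem hxW, hW'.1, hG.1]

/-- A six part is its two curve points plus a quad part. [folklore] -/
theorem IsSixPartS.exists_split [DecidableEq α] {b : Bool} {G : Finset α} (hG : IsSixPartS v b G) :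
    ∃ (C G₁ : Finset α), Disjoint C G₁ ∧ G = C ∪ G₁ ∧ C.card = 2 ∧ (∀ x ∈ C, v x = Sum.inl b) ∧ IsQuadPartS v b G₁ := by
  set C := G.filter fun x => v x = Sum.inl b with hC
  obtain ⟨W, hW, hW'⟩ := exists_quadPartS_of_counts (v := v) (T := G) b fun a => by rw [hG.2.2 a]; exact one_pos
  have hCW : Disjoint C W := by
    rw [Finset.disjoint_left]
    intro x hxC hxW
    obtain ⟨a, ha⟩ := hW'.exists_eq hxW
    rw [(Finset.mem_filter.1 hxC).2] at ha; exact Sum.inl_ne_inr ha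
  refine ⟨C, W, hCW, ?_, hG.2.1, fun x hx => (Finset.mem_filter.1 hx).2, hW'⟩
  symm
  apply Finset.eq_of_subset_of_card_le (Finset.union_subset (Finset.filter_subset _ _) hW)
  rw [Finset.card_union_of_disjoint hCW, hG.2.1, hW'.1, hG.1]

/-- An eight part is its curve point, a three part of sign `b` and a quad part of sign `¬b`. [folklore] -/
theorem IsEightPartS.exists_split [DecidableEq α] {b : Bool} {G : Finset α} (hG : IsEightPartS v b G) :
    ∃ (x : α) (G₁ G₂ : Finset α), x ∉ G₁ ∧ x ∉ G₂ ∧ Disjoint G₁ G₂ ∧ G = insert x (G₁ ∪ G₂) ∧ v x = Sum.inl (!b) ∧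
      IsThreePartS v b G₁ ∧ IsQuadPartS v (!b) G₂ := by
  obtain ⟨x, hxf⟩ := Finset.card_eq_one.1 hG.2.1
  have hx : x ∈ G.filter fun x => v x = Sum.inl (!b) := by rw [hxf]; exact Finset.mem_singleton_self x
  obtain ⟨hxG, hvx⟩ := Finset.mem_filter.1 hx
  obtain ⟨W₁, hW₁, hW₁'⟩ := exists_threePartS_of_counts (v := v) (T := G) b fun a => by rw [hG.2.2.1 a]; exact one_pos
  obtain ⟨W₂, hW₂, hW₂'⟩ := exists_quadPartS_of_counts (v := v) (T := G) (!b) fun a => by rw [hG.2.2.2 a]; exact one_pos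
  have hxW₁ : x ∉ W₁ := fun h => by
    obtain ⟨a, ha⟩ := hW₁'.exists_eq h
    rw [hvx] at ha; exact Sum.inl_ne_inr ha
  have hxW₂ : x ∉ W₂ := fun h => by
    obtain ⟨a, ha⟩ := hW₂'.exists_eq h
    rw [hvx] at ha; exact Sum.inl_ne_inr ha
  have hW : Disjoint W₁ W₂ := by
    rw [Finset.disjoint_left]
    intro z hz1 hz2
    obtain ⟨a, ha⟩ := hW₁'.exists_eq hz1
    obtain ⟨a', ha'⟩ := hW₂'.exists_eq hz2
    have := ha.symm.trans ha'
    simp at this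
  refine ⟨x, W₁, W₂, hxW₁, hxW₂, hW, ?_, hvx, hW₁', hW₂'⟩
  symm
  apply Finset.eq_of_subset_of_card_le (Finset.insert_subset hxG (Finset.union_subset hW₁ hW₂))
  rw [Finset.card_insert_of_notMem (by rw [Finset.mem_union]; exact fun h => h.elim hxW₁ hxW₂),
    Finset.card_union_of_disjoint hW, hW₁'.1, hW₂'.1, hG.1]

/-- A ten part is two three parts of sign `b` and a quad part of sign `¬b`. [folklore] -/
theorem IsTenPartS.exists_split [DecidableEq α] {b : Bool} {G : Finset α} (hG : IsTenPartS v b G) :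
    ∃ (G₀ G₁ G₂ : Finset α), Disjoint G₀ G₁ ∧ Disjoint G₀ G₂ ∧ Disjoint G₁ G₂ ∧ G = G₀ ∪ G₁ ∪ G₂ ∧
      IsThreePartS v b G₀ ∧ IsThreePartS v b G₁ ∧ IsQuadPartS v (!b) G₂ := by
  obtain ⟨W₀, hW₀, hW₀'⟩ := exists_threePartS_of_counts (v := v) (T := G) b fun a => by rw [hG.2.1 a]; exact two_pos
  have hrest : ∀ a : Fin 3, 0 < ((G \ W₀).filter fun x => v x = Sum.inr (Sum.inl (a, b))).card := by
    intro a
    have h1 : ((G \ W₀).filter fun x => v x = Sum.inr (Sum.inl (a, b))).card =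
        (G.filter fun x => v x = Sum.inr (Sum.inl (a, b))).card - (W₀.filter fun x => v x = Sum.inr (Sum.inl (a, b))).card := by
      rw [← Finset.card_sdiff_of_subset (Finset.filter_subset_filter _ hW₀)]
      congr 1
      ext x
      simp only [Finset.mem_filter, Finset.mem_sdiff]
      tauto
    rw [h1, hG.2.1 a, hW₀'.2 a]; exact one_pos
  obtain ⟨W₁, hW₁, hW₁'⟩ := exists_threePartS_of_counts (v := v) (T := G \ W₀) b hrest
  obtain ⟨W₂, hW₂, hW₂'⟩ := exists_quadPartS_of_counts (v := v) (T := G) (!b) fun a => by rw [hG.2.2 a]; exact one_pos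
  have h01 : Disjoint W₀ W₁ := by
    rw [Finset.disjoint_left]
    exact fun z hz0 hz1 => (Finset.mem_sdiff.1 (hW₁ hz1)).2 hz0
  have h02 : Disjoint W₀ W₂ := by
    rw [Finset.disjoint_left]
    intro z hz0 hz2
    obtain ⟨a, ha⟩ := hW₀'.exists_eq hz0
    obtain ⟨a', ha'⟩ := hW₂'.exists_eq hz2
    have := ha.symm.trans ha'
    simp at this
  have h12 : Disjoint W₁ W₂ := by
    rw [Finset.disjoint_left]
    intro z hz1 hz2
    obtain ⟨a, ha⟩ := hW₁'.exists_eq hz1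
    obtain ⟨a', ha'⟩ := hW₂'.exists_eq hz2
    have := ha.symm.trans ha'
    simp at this
  refine ⟨W₀, W₁, W₂, h01, h02, h12, ?_, hW₀', hW₁', hW₂'⟩
  symm
  have hW₁G : W₁ ⊆ G := fun z hz => (Finset.mem_sdiff.1 (hW₁ hz)).1
  apply Finset.eq_of_subset_of_card_le (Finset.union_subset (Finset.union_subset hW₀ hW₁G) hW₂)
  rw [Finset.card_union_of_disjoint (Finset.disjoint_union_left.2 ⟨h02, h12⟩), Finset.card_union_of_disjoint h01,
    hW₀'.1, hW₁'.1, hW₂'.1, hG.1]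

/-! ### The parts are balanced at every pair of permutations -/

section Balanced

/-- **A pair part is balanced** (its count function is conjugation-invariant, so all defects vanish).
[cite: Gordon1999HodgeAVSurvey, 9.2.2] -/
theorem IsPairPartS.balancedS [DecidableEq α] {G : Finset α} (hG : IsPairPartS v G) (π : Equiv.Perm (Fin 3) × Equiv.Perm (Fin 4)) :
    2 * (G.filter fun x => v x ∈ phiS π).card = G.card := by
  obtain ⟨y, hy⟩ := hG.count_eq
  have hsymm : ∀ z : PtS, (G.filter fun x => v x = cjS z).card = (G.filter fun x => v x = z).card := by
    intro z
    rw [hy, hy]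
    have h1 : cjS z = y ↔ z = cjS y := ⟨fun h => by rw [← h, cjS_cjS], fun h => by rw [h, cjS_cjS]⟩
    have h2 : cjS z = cjS y ↔ z = y := ⟨fun h => by rw [← cjS_cjS z, h, cjS_cjS], fun h => by rw [h]⟩
    simp only [h1, h2, or_comm]
  refine balancedS_of_defect (v := v) (t₁ := 0) (t₂ := 0) (fun a => ?_) (fun a => ?_) ?_ π
  · have h := hsymm (Sum.inr (Sum.inl (a, true)))
    rw [cjS_inr_inl, Bool.not_true] at h
    rw [h, sub_self]
  · have h := hsymm (Sum.inr (Sum.inr (a, true)))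
    rw [cjS_inr_inr, Bool.not_true] at h
    rw [h, sub_self]
  · have h := hsymm (Sum.inl true)
    rw [cjS_inl, Bool.not_true] at h
    rw [h, sub_self]; ring

/-- **A four part is balanced** (defects `(t₁, t₂; e) = (±1, 0; ±1)`: the Weil class of `T × E` is a Hodge class for every conjugate
type). [cite: MoonenZarhin1995Duke, Thm. 2.4] -/
theorem IsFourPartS.balancedS [DecidableEq α] {b : Bool} {G : Finset α} (hG : IsFourPartS v b G)
    (π : Equiv.Perm (Fin 3) × Equiv.Perm (Fin 4)) : 2 * (G.filter fun x => v x ∈ phiS π).card = G.card := by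
  obtain ⟨x, G₁, hxG₁, rfl, hvx, hG₁⟩ := hG.exists_split
  have hcount : ∀ z : PtS, ((insert x G₁).filter fun x => v x = z).card =
      (if z = Sum.inl b then 1 else 0) + (G₁.filter fun x => v x = z).card := fun z => by
    rw [Finset.filter_insert, hvx]
    by_cases hz : Sum.inl b = z
    · rw [if_pos hz, if_pos hz.symm, Finset.card_insert_of_notMem fun h => hxG₁ (Finset.mem_of_mem_filter _ h), add_comm]
    · rw [if_neg hz, if_neg (Ne.symm hz), zero_add]
  refine balancedS_of_defect (v := v) (t₁ := if b then 1 else -1) (t₂ := 0) (fun a => ?_) (fun a => ?_) ?_ π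
  · rw [hcount, hcount, hG₁.card_filter_inr_inl, hG₁.card_filter_inr_inl, if_neg Sum.inr_ne_inl, if_neg Sum.inr_ne_inl]
    cases b <;> simp
  · rw [hcount, hcount, hG₁.card_filter_inr_inr, hG₁.card_filter_inr_inr, if_neg Sum.inr_ne_inl, if_neg Sum.inr_ne_inl]
    simp
  · rw [hcount, hcount, hG₁.card_filter_inl, hG₁.card_filter_inl]
    cases b <;> simp

/-- **A six part is balanced** (defects `(0, ±1; ±2)`: the Weil class of `B × E × E`). [cite: MoonenZarhin1995Duke, Thm. 2.4] -/
theorem IsSixPartS.balancedS [DecidableEq α] {b : Bool} {G : Finset α} (hG : IsSixPartS v b G)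
    (π : Equiv.Perm (Fin 3) × Equiv.Perm (Fin 4)) : 2 * (G.filter fun x => v x ∈ phiS π).card = G.card := by
  obtain ⟨C, G₁, hCG₁, rfl, hC, hvC, hG₁⟩ := hG.exists_split
  have hcount : ∀ z : PtS, ((C ∪ G₁).filter fun x => v x = z).card =
      (if z = Sum.inl b then 2 else 0) + (G₁.filter fun x => v x = z).card := fun z => by
    rw [Finset.filter_union, Finset.card_union_of_disjoint (Finset.disjoint_filter_filter hCG₁)]
    congr 1
    by_cases hz : z = Sum.inl b
    · rw [if_pos hz, Finset.filter_true_of_mem fun x hx => (hvC x hx).trans hz.symm, hC]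
    · rw [if_neg hz, Finset.card_eq_zero, Finset.filter_eq_empty_iff]
      exact fun x hx h => hz (h.symm.trans (hvC x hx))
  refine balancedS_of_defect (v := v) (t₁ := 0) (t₂ := if b then 1 else -1) (fun a => ?_) (fun a => ?_) ?_ π
  · rw [hcount, hcount, hG₁.card_filter_inr_inl, hG₁.card_filter_inr_inl, if_neg Sum.inr_ne_inl, if_neg Sum.inr_ne_inl]
    simp
  · rw [hcount, hcount, hG₁.card_filter_inr_inr, hG₁.card_filter_inr_inr, if_neg Sum.inr_ne_inl, if_neg Sum.inr_ne_inl]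
    cases b <;> simp
  · rw [hcount, hcount, hG₁.card_filter_inl, hG₁.card_filter_inl]
    cases b <;> simp

/-- **An eight part is balanced** (defects `(±1, ∓1; ∓1)`: the Weil class of `Ē × T × B̄`). [cite: MoonenZarhin1995Duke, Thm. 2.4] -/
theorem IsEightPartS.balancedS [DecidableEq α] {b : Bool} {G : Finset α} (hG : IsEightPartS v b G)
    (π : Equiv.Perm (Fin 3) × Equiv.Perm (Fin 4)) : 2 * (G.filter fun x => v x ∈ phiS π).card = G.card := by
  obtain ⟨x, G₁, G₂, hx₁, hx₂, h12, rfl, hvx, hG₁, hG₂⟩ := hG.exists_split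
  have hcount : ∀ z : PtS, ((insert x (G₁ ∪ G₂)).filter fun x => v x = z).card =
      (if z = Sum.inl (!b) then 1 else 0) + (G₁.filter fun x => v x = z).card + (G₂.filter fun x => v x = z).card := fun z => by
    rw [Finset.filter_insert, hvx]
    have hU : ((G₁ ∪ G₂).filter fun x => v x = z).card = (G₁.filter fun x => v x = z).card + (G₂.filter fun x => v x = z).card := by
      rw [Finset.filter_union, Finset.card_union_of_disjoint (Finset.disjoint_filter_filter h12)]
    by_cases hz : Sum.inl (!b) = z
    · rw [if_pos hz, if_pos hz.symm, Finset.card_insert_of_notMem fun h => ?_, hU]; · ring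
      rcases Finset.mem_union.1 (Finset.mem_of_mem_filter _ h) with h | h
      exacts [hx₁ h, hx₂ h]
    · rw [if_neg hz, if_neg (Ne.symm hz), zero_add, hU]
  refine balancedS_of_defect (v := v) (t₁ := if b then 1 else -1) (t₂ := if b then -1 else 1) (fun a => ?_) (fun a => ?_) ?_ π
  · rw [hcount, hcount, hG₁.card_filter_inr_inl, hG₁.card_filter_inr_inl, hG₂.card_filter_inr_inl, hG₂.card_filter_inr_inl,
      if_neg Sum.inr_ne_inl, if_neg Sum.inr_ne_inl]
    cases b <;> simp
  · rw [hcount, hcount, hG₁.card_filter_inr_inr, hG₁.card_filter_inr_inr, hG₂.card_filter_inr_inr, hG₂.card_filter_inr_inr,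
      if_neg Sum.inr_ne_inl, if_neg Sum.inr_ne_inl]
    cases b <;> simp
  · rw [hcount, hcount, hG₁.card_filter_inl, hG₁.card_filter_inl, hG₂.card_filter_inl, hG₂.card_filter_inl]
    cases b <;> simp

/-- **A ten part is balanced** (defects `(±2, ∓1; 0)`: the Weil class of `T × T × B̄`). [cite: MoonenZarhin1995Duke, Thm. 2.4] -/
theorem IsTenPartS.balancedS [DecidableEq α] {b : Bool} {G : Finset α} (hG : IsTenPartS v b G)
    (π : Equiv.Perm (Fin 3) × Equiv.Perm (Fin 4)) : 2 * (G.filter fun x => v x ∈ phiS π).card = G.card := by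
  obtain ⟨G₀, G₁, G₂, h01, h02, h12, rfl, hG₀, hG₁, hG₂⟩ := hG.exists_split
  have hcount : ∀ z : PtS, ((G₀ ∪ G₁ ∪ G₂).filter fun x => v x = z).card =
      (G₀.filter fun x => v x = z).card + (G₁.filter fun x => v x = z).card + (G₂.filter fun x => v x = z).card := fun z => by
    rw [Finset.filter_union, Finset.card_union_of_disjoint (Finset.disjoint_filter_filter (Finset.disjoint_union_left.2 ⟨h02, h12⟩)),
      Finset.filter_union, Finset.card_union_of_disjoint (Finset.disjoint_filter_filter h01)]
  refine balancedS_of_defect (v := v) (t₁ := if b then 2 else -2) (t₂ := if b then -1 else 1) (fun a => ?_) (fun a => ?_) ?_ π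
  · rw [hcount, hcount, hG₀.card_filter_inr_inl, hG₀.card_filter_inr_inl, hG₁.card_filter_inr_inl, hG₁.card_filter_inr_inl,
      hG₂.card_filter_inr_inl, hG₂.card_filter_inr_inl]
    cases b <;> simp
  · rw [hcount, hcount, hG₀.card_filter_inr_inr, hG₀.card_filter_inr_inr, hG₁.card_filter_inr_inr, hG₁.card_filter_inr_inr,
      hG₂.card_filter_inr_inr, hG₂.card_filter_inr_inr]
    cases b <;> simp
  · rw [hcount, hcount, hG₀.card_filter_inl, hG₀.card_filter_inl, hG₁.card_filter_inl, hG₁.card_filter_inl,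
      hG₂.card_filter_inl, hG₂.card_filter_inl]
    cases b <;> simp

end Balanced

end Summit.HodgeConjecture.CorCM.Census.SexticOcticWeil
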